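import Literature.NumberTheory.EllipticCurves.NonvanishingTwistsHoffsteinLuoMomentProofs
import HarnessLib

/-!
# Hoffstein–Luo for elliptic curves from the first moment for NEWFORMS (as printed) and modularity

`NonvanishingTwistsHoffsteinLuoMomentProofs.lean` reduces the named fact
`Literature.NumberTheory.EllipticCurves.HoffsteinLuo1997_exists_twist_L_one_ne_zero`
(J. Hoffstein, W. Luo, Math. Res. Lett. **4** (1997), 435–444 [HoffsteinLuo1997], Theorem, for
the newform of an elliptic curve) to positivity (`WeierstrassCurve.re_entireLFunction_one_nonneg`)
and to Hoffstein–Luo's mean-value input — displays (3), (5), (13) — written for the twisted central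
values `L(E^{(εn)}, 1)` of an elliptic curve. The paper states that input for a holomorphic
NEWFORM `f` of level `N` and trivial character (p. 435: "`f` a normalized holomorphic newform of
weight `k ≥ 2`, level `N` with trivial nebentype"; `c_n = L(k/2, f, χ_n) F(|n|/Y)`, display (3)).
This file proves the last translation step, so that the remaining analytic hypothesis is
LITERALLY the printed one (weight `2`):

`HoffsteinLuo1997_exists_twist_L_one_ne_zero_of_newform_firstMoment (hpos) (hmod) (hmomentNF) :
  HoffsteinLuo1997_exists_twist_L_one_ne_zero`,

with `hpos = WeierstrassCurve.re_entireLFunction_one_nonneg` (Guo 1996),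
`hmod = exists_isNewformOf` (modularity, Breuil–Conrad–Diamond–Taylor 2001) — both EXISTING
named facts — and `hmomentNF` = displays (3), (5), (13) for newforms `f ∈ S₂(Γ₀(N))`
(`IsNewform0`), the central value `L(1, f, χ_d)` (`d = εn ∈ Δ^ε`) being rendered, as in
`NonvanishingTwistsHoffsteinLuoNewformProofs.lean`, as the value at `1` of an entire function
agreeing with `∑ χ_d(m) a_m(f) m⁻ˢ`, `χ_d(m) = (m/|d|) = jacobiSym m n`, on `re s > 2` (Hecke).
The translation `L(s, f_E, χ_d) = L(E^{(d)}, s)` for `d ≡ 1 (mod 4)` square-free and coprime to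
`N_E` is `entireLFunction_quadraticTwist_eq_of_LSeries` (the argument of
`HoffsteinLuo1997_exists_twist_L_one_ne_zero_of_newform`: twist coefficients
`LFunction_quadraticTwist_apply_of_int_gcd_eq_one`, identity theorem on `re s > 3/2`,
uniqueness of the entire continuation); the elements of `Δ^ε` qualify
(`HoffsteinLuo1997.coprime_of_modEq_sq`, `emod_four_eq_one_of_modEq_sq`). No definition and no
named fact is introduced (D-0026).

`HoffsteinLuo1997_exists_twist_L_one_ne_zero_of_newform_levelOfDistribution (hpos) (hmod)
(hlevelNF)` is the same reduction with the analytic input in the weakest form §2 consumes: for the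
same newform data, SOME level of distribution `Y^θ` with `θ > 2/5` and a power saving
(`θ (r + 1) > 2`, `r = 4`, p. 439), through
`HoffsteinLuo1997_exists_twist_L_one_ne_zero_of_levelOfDistribution` of
`NonvanishingTwistsHoffsteinLuoMomentProofs.lean`.

`HoffsteinLuo1997.forall_exists_twist_card_le_of_newform_levelOfDistribution r (hpos) (hmod)
(hlevelNF_r)` is the same reduction with `r` prime factors in place of `4` (§2 of the paper with
"`r` a suitably large absolute constant", p. 438): a newform-level AP law with level `θ`,
`θ (r + 1) > 2`, gives the fact's statement with `r` in place of `4`, through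
`HoffsteinLuo1997.forall_exists_twist_card_le_of_levelOfDistribution` of
`NonvanishingTwistsHoffsteinLuoMomentProofs.lean` (whose module docstring records which `r` the
printed mean-value theorems give: (13): `4`; (5) alone: `70`; Radziwiłł–Soundararajan 2015,
Prop. 2, the law whose proof is complete in print: `20`). The translation
`Λ(n) = L(W^{(εn)}, 1)` on `Δ^ε` common to the three reductions is
`HoffsteinLuo1997.entireLFunction_quadraticTwist_one_eq_of_modEq_sq`.

## References

* [HoffsteinLuo1997] J. Hoffstein, W. Luo, Math. Res. Lett. 4 (1997) 435–444, §1 (setting,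
  p. 435), §2 (3), (5), §3 (13) — held, read in full.
* [BCDTJAMS2001] Breuil–Conrad–Diamond–Taylor, Thm. A (`exists_isNewformOf`).
* [Guo1996] J. Guo, Duke Math. J. 83 (1996) (`re_entireLFunction_one_nonneg`).
-/

noncomputable section

open scoped MatrixGroups ModularForm

open Finset Filter Topology Complex CongruenceSubgroup WeierstrassCurve
open Literature.NumberTheory.EllipticCurves.ModularForms

namespace Literature.NumberTheory.EllipticCurves

namespace HoffsteinLuo1997

/-- If `d ≡ ν² (mod 4M)` with `ν` coprime to `4M`, then `d ≡ 1 (mod 4)` (`ν` is odd), i.e. the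
elements of `Δ^±` are odd discriminants. [cite: HoffsteinLuo1997, §2 p. 436] -/
theorem emod_four_eq_one_of_modEq_sq {d : ℤ} {M ν : ℕ} (hν : ν.Coprime (4 * M))
    (h : d ≡ ((ν : ℤ) ^ 2) [ZMOD ((4 * M : ℕ) : ℤ)]) : d % 4 = 1 := by
  have h4 : (4 : ℤ) ∣ ((4 * M : ℕ) : ℤ) := ⟨M, by push_cast; ring⟩
  have hmod : d ≡ ((ν : ℤ) ^ 2) [ZMOD 4] := h.of_dvd h4
  have hν2 : ¬ 2 ∣ ν := fun h2 =>
    absurd (Nat.eq_one_of_dvd_coprimes hν h2 (dvd_mul_of_dvd_left (by norm_num) M)) (by norm_num)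
  obtain ⟨k, hk⟩ : Odd ν := Nat.odd_iff.mpr (Nat.two_dvd_ne_zero.mp hν2)
  have hsq : ((ν : ℤ) ^ 2) = 4 * (k * k + k) + 1 := by
    rw [hk]; push_cast; ring
  unfold Int.ModEq at hmod
  omega

end HoffsteinLuo1997

open HoffsteinLuo1997

/-- **`L(s, f_E, χ_d) = L(E^{(d)}, s)`**: if `f` is the newform of the elliptic curve `W/ℚ`
(`IsNewformOf W f`), `d ≡ 1 (mod 4)` is square-free and coprime to `N_W`, and `L` is an entire
function with `L(s) = ∑ χ_d(n) aₙ(f) n⁻ˢ` (`χ_d(n) = (n/|d|)`) for `re s > 2`, then `L` is the entire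
`L`-function of the quadratic twist `W^{(d)}`: `(W.quadraticTwist d).entireLFunction = L`.
(Twist coefficients `aₙ(E^{(d)}) = χ_d(n) aₙ(E)`, `LFunction_quadraticTwist_apply_of_int_gcd_eq_one`;
identity theorem on `re s > 3/2`; uniqueness of the entire continuation. This is the argument of
`HoffsteinLuo1997_exists_twist_L_one_ne_zero_of_newform`, isolated.)
[cite: SilvermanAEC2009, X.2 and Exercise 10.16] -/
theorem entireLFunction_quadraticTwist_eq_of_LSeries (W : WeierstrassCurve ℚ) [W.IsElliptic]
    {N : ℕ} [NeZero N] {f : CuspForm (Gamma0 N) 2} (hf : IsNewformOf W f)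
    {d : ℤ} (hd4 : d % 4 = 1) (hsq : Squarefree d) (hgcd : Int.gcd d (W.conductorNorm ℤ) = 1)
    {L : ℂ → ℂ} (hLdiff : Differentiable ℂ L)
    (hLeq : ∀ s : ℂ, (2 : ℝ) < s.re →
      L s = LSeries (fun n : ℕ ↦ (jacobiSym n d.natAbs : ℂ) * cuspCoeff f n) s) :
    (W.quadraticTwist (d : ℚ)).entireLFunction = L := by
  have hcoef : ((↑) ∘ (W.quadraticTwist (d : ℚ)).LFunction : ℕ → ℂ) =
      fun n : ℕ ↦ (jacobiSym n d.natAbs : ℂ) * cuspCoeff f n := by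
    funext n
    simp only [Function.comp_apply, LFunction_quadraticTwist_apply_of_int_gcd_eq_one W hd4 hsq hgcd n,
      Int.cast_mul, hf.2 n]
  have hLeq' : ∀ s : ℂ, (2 : ℝ) < s.re → L s = (W.quadraticTwist (d : ℚ)).LSeries s := by
    intro s hs
    rw [WeierstrassCurve.LSeries, hcoef]
    exact hLeq s hs
  have hana : AnalyticOnNhd ℂ (W.quadraticTwist (d : ℚ)).LSeries {s : ℂ | (3 / 2 : ℝ) < s.re} :=
    (W.quadraticTwist (d : ℚ)).analyticOnNhd_LSeries
  have hLana : AnalyticOnNhd ℂ L {s : ℂ | (3 / 2 : ℝ) < s.re} :=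
    (hLdiff.differentiableOn.analyticOnNhd isOpen_univ).mono (Set.subset_univ _)
  have hpre : IsPreconnected {s : ℂ | (3 / 2 : ℝ) < s.re} :=
    (convex_halfSpace_re_gt (3 / 2 : ℝ)).isPreconnected
  have h3 : (3 : ℂ) ∈ {s : ℂ | (3 / 2 : ℝ) < s.re} := by
    simp only [Set.mem_setOf_eq]
    norm_num
  have hev : L =ᶠ[𝓝 (3 : ℂ)] (W.quadraticTwist (d : ℚ)).LSeries := by
    have hopen : IsOpen {s : ℂ | (2 : ℝ) < s.re} := isOpen_lt continuous_const continuous_re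
    filter_upwards [hopen.mem_nhds (show (2 : ℝ) < (3 : ℂ).re by norm_num)] with s hs
    exact hLeq' s hs
  have hEqOn : Set.EqOn L (W.quadraticTwist (d : ℚ)).LSeries {s : ℂ | (3 / 2 : ℝ) < s.re} :=
    hLana.eqOn_of_preconnected_of_eventuallyEq hana hpre h3 hev
  have hmem : L ∈ (W.quadraticTwist (d : ℚ)).entireContinuations := ⟨hLdiff, fun s hs ↦ hEqOn hs⟩
  have hT : (W.quadraticTwist (d : ℚ)).HasEntireLFunction := ⟨L, hmem⟩
  exact (W.quadraticTwist (d : ℚ)).subsingleton_entireContinuations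
    ((W.quadraticTwist (d : ℚ)).entireLFunction_mem hT) hmem

/-- **`Λ(n) = L(W^{(εn)}, 1)` on `Δ^ε`.** If `f` is the newform of the elliptic curve `W/ℚ`,
`N_W ∣ M`, `ε = ±1`, `n` is square-free with `εn ≡ ν² (mod 4M)` for some `ν` coprime to `4M`,
and `L` is an entire function equal to `∑ (m/n) a_m(f) m⁻ˢ` on `re s > 2`, then
`L(W^{(εn)}, 1) = L(1)`: `εn ≡ 1 (mod 4)` is square-free and coprime to `N_W`
(`emod_four_eq_one_of_modEq_sq`, `coprime_of_modEq_sq`), so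
`entireLFunction_quadraticTwist_eq_of_LSeries` applies (`(m/|εn|) = (m/n)`). The translation step
shared by the reductions below. [cite: HoffsteinLuo1997, §1 p. 435 and §2 (3)] -/
theorem HoffsteinLuo1997.entireLFunction_quadraticTwist_one_eq_of_modEq_sq
    (W : WeierstrassCurve ℚ) [W.IsElliptic] {N : ℕ} [NeZero N] {f : CuspForm (Gamma0 N) 2}
    (hf : IsNewformOf W f) {M : ℕ} (hNM : W.conductorNorm ℤ ∣ M) {ε : ℤ} (hε : ε = 1 ∨ ε = -1)
    {n : ℕ} (hsq : Squarefree n) {ν : ℕ} (hν : ν.Coprime (4 * M))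
    (hmodν : (ε * n : ℤ) ≡ ((ν : ℤ) ^ 2) [ZMOD ((4 * M : ℕ) : ℤ)])
    {L : ℂ → ℂ} (hLdiff : Differentiable ℂ L)
    (hLeq : ∀ s : ℂ, (2 : ℝ) < s.re →
      L s = LSeries (fun m : ℕ ↦ (jacobiSym m n : ℂ) * cuspCoeff f m) s) :
    (W.quadraticTwist ((ε * n : ℤ) : ℚ)).entireLFunction 1 = L 1 := by
  have hεabs : ε.natAbs = 1 := by rcases hε with h | h <;> simp [h]
  have hd4 : (ε * n : ℤ) % 4 = 1 := emod_four_eq_one_of_modEq_sq hν hmodν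
  have hnat : (ε * n : ℤ).natAbs = n := by
    rw [Int.natAbs_mul, hεabs, one_mul, Int.natAbs_natCast]
  have hsqd : Squarefree (ε * n : ℤ) := by rw [← Int.squarefree_natAbs, hnat]; exact hsq
  have hcop : n.Coprime (4 * M) := coprime_of_modEq_sq hν hmodν
  have hgcd : Int.gcd (ε * n : ℤ) (W.conductorNorm ℤ) = 1 := by
    rw [Int.gcd_eq_natAbs, hnat, Int.natAbs_natCast]
    exact Nat.Coprime.coprime_dvd_right (hNM.trans (Dvd.intro_left 4 rfl)) hcop
  have hLeq' : ∀ s : ℂ, (2 : ℝ) < s.re →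
      L s = LSeries (fun m : ℕ ↦ (jacobiSym m (ε * n : ℤ).natAbs : ℂ) * cuspCoeff f m) s := by
    rw [hnat]; exact hLeq
  rw [entireLFunction_quadraticTwist_eq_of_LSeries W hf hd4 hsqd hgcd hLdiff hLeq']

/-- **Hoffstein–Luo for elliptic curves from positivity, modularity and the first moment for
newforms (displays (3), (5), (13) as printed).** The named fact
`HoffsteinLuo1997_exists_twist_L_one_ne_zero` follows from
(1) `hpos = WeierstrassCurve.re_entireLFunction_one_nonneg` (`Re L(E, 1) ≥ 0`; Guo 1996),
(2) `hmod = exists_isNewformOf` (modularity), and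
(3) `hmomentNF`, Hoffstein–Luo's mean-value input for a newform `f ∈ S₂(Γ₀(N))` (`IsNewform0 f`;
"`f` a normalized holomorphic newform of weight `k ≥ 2`, level `N` with trivial nebentype",
here `k = 2`): for every `M ≠ 0` with `N ∣ M` there are `ε = ±1`, `C > 0`, `B ≥ 0`, a
multiplicative `ρ` with `0 ≤ ρ(p) < p`, `|ρ(p) − 1| ≤ B/p` for `p ∤ 4M` ((8); "`ρ(p) = 1 + O(1/p)`",
p. 437), a weight `F ≥ 0` supported in `[a, b] ⊂ (0, 1)` (p. 436) and central values
`Λ(n) = L(1, f, χ_{εn})` (`Lv n`) for `εn ∈ Δ^ε` — `Λ(n)` is the value at `1` of an entire function equal to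
`∑ (m/n) a_m(f) m⁻ˢ` on `re s > 2` (Hecke; `χ_{εn}(m) = (m/n)` as `εn ≡ 1 (mod 4)`) — such that for
every `κ > 0`, for `Y ≥ Y₁(κ)` and `1 ≤ D ≤ Y`:
`∑_{d < D, μ(d) ≠ 0, (d, 4M) = 1, p ∣ d ⇒ p < √D} ‖∑_{n ≤ Y, d ∣ n, εn ∈ Δ^ε} Λ(n) F(n/Y) − C (ρ(d)/d) Y‖
 ≤ K Y^{1/2} D^{1+κ}` (display (5) with the remainder bound (13); `κ` is the paper's `ε`). Proof: for elliptic `W`, the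
newform `f_W` (`hmod`) turns `hmomentNF` into the hypothesis of
`HoffsteinLuo1997_exists_twist_L_one_ne_zero_of_firstMoment`, because for `εn ∈ Δ^ε`
(`≡ 1 (mod 4)`, square-free, coprime to `4M ⊇ N_W`) the entire function of `hmomentNF` IS
`L(W^{(εn)}, ·)` (`entireLFunction_quadraticTwist_eq_of_LSeries`), so `Λ(n) = L(W^{(εn)}, 1)`.
[cite: HoffsteinLuo1997, Theorem and §2 (3), (5), §3 (13)] -/
theorem HoffsteinLuo1997_exists_twist_L_one_ne_zero_of_newform_firstMoment
    (hpos : WeierstrassCurve.re_entireLFunction_one_nonneg) (hmod : exists_isNewformOf)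
    (hmomentNF : ∀ {N : ℕ} [NeZero N] (f : CuspForm (Gamma0 N) 2), IsNewform0 f →
      ∀ (M : ℕ), M ≠ 0 → N ∣ M →
      ∃ (ε : ℤ) (C B a b : ℝ) (ρ : ArithmeticFunction ℝ) (F : ℝ → ℝ) (Lv : ℕ → ℂ),
        (ε = 1 ∨ ε = -1) ∧ 0 < C ∧ 0 ≤ B ∧ ρ.IsMultiplicative ∧
        (∀ p : ℕ, p.Prime → ¬ p ∣ 4 * M → 0 ≤ ρ p ∧ ρ p < p ∧ |ρ p - 1| ≤ B / p) ∧
        0 < a ∧ b < 1 ∧ (∀ t, 0 ≤ F t) ∧ (∀ t, F t ≠ 0 → a ≤ t ∧ t ≤ b) ∧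
        (∀ n : ℕ, Squarefree n → (∃ ν ∈ Finset.range (4 * M), ν.Coprime (4 * M) ∧
            (ε * n : ℤ) ≡ ((ν : ℤ) ^ 2) [ZMOD ((4 * M : ℕ) : ℤ)]) →
          ∃ L : ℂ → ℂ, Differentiable ℂ L ∧
            (∀ s : ℂ, (2 : ℝ) < s.re →
              L s = LSeries (fun m : ℕ ↦ (jacobiSym m n : ℂ) * cuspCoeff f m) s) ∧ L 1 = Lv n) ∧
        ∀ κ : ℝ, 0 < κ → ∃ K Y₁ : ℝ, ∀ Y D : ℝ, Y₁ ≤ Y → 1 ≤ D → D ≤ Y →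
          ∑ d ∈ (Finset.range ⌈D⌉₊).filter (fun d : ℕ => Squarefree d ∧ d.Coprime (4 * M) ∧
              ∀ p ∈ d.primeFactors, (p : ℝ) < Real.sqrt D),
            ‖(∑ n ∈ (Finset.Ioc 0 ⌊Y⌋₊).filter (fun n : ℕ => d ∣ n ∧ Squarefree n ∧
                  ∃ ν ∈ Finset.range (4 * M), ν.Coprime (4 * M) ∧
                    (ε * n : ℤ) ≡ ((ν : ℤ) ^ 2) [ZMOD ((4 * M : ℕ) : ℤ)]),
                Lv n * (F (n / Y) : ℂ)) - ((C * (ρ d / d) * Y : ℝ) : ℂ)‖ ≤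
              K * Y ^ (1 / 2 : ℝ) * D ^ (1 + κ)) :
    HoffsteinLuo1997_exists_twist_L_one_ne_zero := by
  refine HoffsteinLuo1997_exists_twist_L_one_ne_zero_of_firstMoment hpos fun W _ M hM0 hNM ↦ ?_
  have hN : 0 < W.conductorNorm ℤ := W.conductorNorm_pos_holds
  haveI : NeZero (W.conductorNorm ℤ) := ⟨hN.ne'⟩
  obtain ⟨f, hf⟩ := hmod W
  obtain ⟨ε, C, B, a, b, ρ, F, Lv, hε, hC, hB, hρ, hρp, ha, hb, hF0, hFsupp, hLv, hlev⟩ :=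
    hmomentNF f hf.1 M hM0 hNM
  -- `Λ(n) = Lv n = L(W^{(εn)}, 1)` on `Δ^ε`
  have hval : ∀ n : ℕ, Squarefree n → (∃ ν ∈ Finset.range (4 * M), ν.Coprime (4 * M) ∧
      (ε * n : ℤ) ≡ ((ν : ℤ) ^ 2) [ZMOD ((4 * M : ℕ) : ℤ)]) →
      (W.quadraticTwist ((ε * n : ℤ) : ℚ)).entireLFunction 1 = Lv n := fun n hsq hmem ↦ by
    obtain ⟨L, hLdiff, hLeq, hL1⟩ := hLv n hsq hmem
    obtain ⟨ν, -, hν, hmodν⟩ := hmem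
    rw [HoffsteinLuo1997.entireLFunction_quadraticTwist_one_eq_of_modEq_sq W hf hNM hε hsq hν
      hmodν hLdiff hLeq, hL1]
  refine ⟨ε, C, B, a, b, ρ, F, hε, hC, hB, hρ, hρp, ha, hb, hF0, hFsupp, fun κ hκ ↦ ?_⟩
  obtain ⟨K, Y₁, hKY⟩ := hlev κ hκ
  refine ⟨K, Y₁, fun Y D hY hD hDY ↦ le_of_eq_of_le ?_ (hKY Y D hY hD hDY)⟩
  refine Finset.sum_congr rfl fun d _ ↦ ?_
  congr 2
  refine Finset.sum_congr rfl fun n hn ↦ ?_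
  rw [Finset.mem_filter] at hn
  rw [hval n hn.2.2.1 hn.2.2.2]

/-- **Hoffstein–Luo for elliptic curves from positivity, modularity and a level of distribution
`θ > 2/5` for weight-`2` NEWFORMS (the weakest analytic input §2 consumes, stated for newforms as
the paper does).** As `HoffsteinLuo1997_exists_twist_L_one_ne_zero_of_newform_firstMoment`, but
the mean-value hypothesis `hlevelNF` on a newform `f ∈ S₂(Γ₀(N))` (`IsNewform0 f`) only asks, for
every `M ≠ 0` with `N ∣ M`, for data `ε = ±1`, `C > 0`, `B ≥ 0`, `ρ` multiplicative with
`0 ≤ ρ(p) < p`, `|ρ(p) − 1| ≤ B/p` (`p ∤ 4M`), a weight `F ≥ 0` supported in `[a, b] ⊂ (0, 1)`,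
central values `Λ(n) = L(1, f, χ_{εn})` (`Lv n`, the value at `1` of an entire function equal to
`∑ (m/n) a_m(f) m⁻ˢ` on `re s > 2`) for `εn ∈ Δ^ε`, and SOME exponent `θ > 2/5` and saving
`δ > 0` with
`∑_{d < Y^θ, μ(d) ≠ 0, (d, 4M) = 1, p ∣ d ⇒ p < Y^{1/5}} ‖∑_{n ≤ Y, d ∣ n, εn ∈ Δ^ε} Λ(n) F(n/Y) − C (ρ(d)/d) Y‖
 ≤ K Y^{1−δ}` for `Y ≥ Y₁` — the AP law (5) with level of distribution `Y^θ`, `θ (r + 1) > 2`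
for `r = 4` (p. 439: "`D = Y^{1/(2+4ε)}` and `r = 4` are admissible"). Display (13) supplies this
for every `θ < 1/2`; so would a remainder bound of the shape `≪ Y^{3/4+θ/2+ε}` (R. Munshi, Acta
Arith. 138 (2009), Thm. 1, for central derivatives) with `2/5 < θ < 1/2`. Proof: for elliptic `W`
the newform `f_W` (`hmod`) turns `hlevelNF` into the hypothesis of
`HoffsteinLuo1997_exists_twist_L_one_ne_zero_of_levelOfDistribution`, since for `εn ∈ Δ^ε` the
entire function of `hlevelNF` is `L(W^{(εn)}, ·)` (`entireLFunction_quadraticTwist_eq_of_LSeries`).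
[cite: HoffsteinLuo1997, Theorem and §2 (3)–(12), §3 p. 439] -/
theorem HoffsteinLuo1997_exists_twist_L_one_ne_zero_of_newform_levelOfDistribution
    (hpos : WeierstrassCurve.re_entireLFunction_one_nonneg) (hmod : exists_isNewformOf)
    (hlevelNF : ∀ {N : ℕ} [NeZero N] (f : CuspForm (Gamma0 N) 2), IsNewform0 f →
      ∀ (M : ℕ), M ≠ 0 → N ∣ M →
      ∃ (ε : ℤ) (C B a b : ℝ) (ρ : ArithmeticFunction ℝ) (F : ℝ → ℝ) (Lv : ℕ → ℂ)
        (θ δ K Y₁ : ℝ),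
        (ε = 1 ∨ ε = -1) ∧ 0 < C ∧ 0 ≤ B ∧ ρ.IsMultiplicative ∧
        (∀ p : ℕ, p.Prime → ¬ p ∣ 4 * M → 0 ≤ ρ p ∧ ρ p < p ∧ |ρ p - 1| ≤ B / p) ∧
        0 < a ∧ b < 1 ∧ (∀ t, 0 ≤ F t) ∧ (∀ t, F t ≠ 0 → a ≤ t ∧ t ≤ b) ∧
        (∀ n : ℕ, Squarefree n → (∃ ν ∈ Finset.range (4 * M), ν.Coprime (4 * M) ∧
            (ε * n : ℤ) ≡ ((ν : ℤ) ^ 2) [ZMOD ((4 * M : ℕ) : ℤ)]) →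
          ∃ L : ℂ → ℂ, Differentiable ℂ L ∧
            (∀ s : ℂ, (2 : ℝ) < s.re →
              L s = LSeries (fun m : ℕ ↦ (jacobiSym m n : ℂ) * cuspCoeff f m) s) ∧ L 1 = Lv n) ∧
        2 / 5 < θ ∧ 0 < δ ∧
        ∀ Y : ℝ, Y₁ ≤ Y →
          ∑ d ∈ (Finset.range ⌈Y ^ θ⌉₊).filter (fun d : ℕ => Squarefree d ∧ d.Coprime (4 * M) ∧
              ∀ p ∈ d.primeFactors, (p : ℝ) < Y ^ (1 / 5 : ℝ)),
            ‖(∑ n ∈ (Finset.Ioc 0 ⌊Y⌋₊).filter (fun n : ℕ => d ∣ n ∧ Squarefree n ∧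
                  ∃ ν ∈ Finset.range (4 * M), ν.Coprime (4 * M) ∧
                    (ε * n : ℤ) ≡ ((ν : ℤ) ^ 2) [ZMOD ((4 * M : ℕ) : ℤ)]),
                Lv n * (F (n / Y) : ℂ)) - ((C * (ρ d / d) * Y : ℝ) : ℂ)‖ ≤ K * Y ^ (1 - δ)) :
    HoffsteinLuo1997_exists_twist_L_one_ne_zero := by
  refine HoffsteinLuo1997_exists_twist_L_one_ne_zero_of_levelOfDistribution hpos
    fun W _ M hM0 hNM ↦ ?_
  have hN : 0 < W.conductorNorm ℤ := W.conductorNorm_pos_holds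
  haveI : NeZero (W.conductorNorm ℤ) := ⟨hN.ne'⟩
  obtain ⟨f, hf⟩ := hmod W
  obtain ⟨ε, C, B, a, b, ρ, F, Lv, θ, δ, K, Y₁, hε, hC, hB, hρ, hρp, ha, hb, hF0, hFsupp, hLv, hθ,
    hδ, hlev⟩ := hlevelNF f hf.1 M hM0 hNM
  -- `Λ(n) = Lv n = L(W^{(εn)}, 1)` on `Δ^ε`
  have hval : ∀ n : ℕ, Squarefree n → (∃ ν ∈ Finset.range (4 * M), ν.Coprime (4 * M) ∧
      (ε * n : ℤ) ≡ ((ν : ℤ) ^ 2) [ZMOD ((4 * M : ℕ) : ℤ)]) →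
      (W.quadraticTwist ((ε * n : ℤ) : ℚ)).entireLFunction 1 = Lv n := fun n hsq hmem ↦ by
    obtain ⟨L, hLdiff, hLeq, hL1⟩ := hLv n hsq hmem
    obtain ⟨ν, -, hν, hmodν⟩ := hmem
    rw [HoffsteinLuo1997.entireLFunction_quadraticTwist_one_eq_of_modEq_sq W hf hNM hε hsq hν
      hmodν hLdiff hLeq, hL1]
  refine ⟨ε, C, B, a, b, ρ, F, θ, δ, K, Y₁, hε, hC, hB, hρ, hρp, ha, hb, hF0, hFsupp, hθ, hδ,
    fun Y hY ↦ le_of_eq_of_le ?_ (hlev Y hY)⟩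
  refine Finset.sum_congr rfl fun d _ ↦ ?_
  congr 2
  refine Finset.sum_congr rfl fun n hn ↦ ?_
  rw [Finset.mem_filter] at hn
  rw [hval n hn.2.2.1 hn.2.2.2]

/-- **Hoffstein–Luo for elliptic curves with `r` prime factors, from positivity, modularity and a
newform-level level of distribution `θ` with `θ (r + 1) > 2`** (§2 of the paper with "`r` a
suitably large absolute constant", p. 438, as a parameter; the newform-level counterpart of
`HoffsteinLuo1997.forall_exists_twist_card_le_of_levelOfDistribution`). As
`HoffsteinLuo1997_exists_twist_L_one_ne_zero_of_newform_levelOfDistribution`, with `θ (r + 1) > 2`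
and prime factors `< Y^{1/(r+1)}` in place of `θ > 2/5` and `< Y^{1/5}`, and the conclusion with
`r` prime factors in place of `4`: for a newform `f ∈ S₂(Γ₀(N))` (`IsNewform0 f`) and `M ≠ 0`
with `N ∣ M`, data `ε = ±1`, `C > 0`, `B ≥ 0`, `ρ` multiplicative (`0 ≤ ρ(p) < p`,
`|ρ(p) − 1| ≤ B/p` for `p ∤ 4M`), `F ≥ 0` supported in `[a, b] ⊂ (0, 1)`, central values
`Λ(n) = L(1, f, χ_{εn})` (`Lv n`, the value at `1` of an entire function equal to
`∑ (m/n) a_m(f) m⁻ˢ` on `re s > 2`) on `Δ^ε`, and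
`∑_{d < Y^θ, μ(d) ≠ 0, (d, 4M) = 1, p ∣ d ⇒ p < Y^{1/(r+1)}} ‖∑_{n ≤ Y, d ∣ n, εn ∈ Δ^ε} Λ(n) F(n/Y) − C (ρ(d)/d) Y‖
 ≤ K Y^{1−δ}` for `Y ≥ Y₁`. With `r = 4` this is the level `θ > 2/5` of display (13); with
`r = 20` a level `θ > 2/21` — for `f = f_E` supplied, with `θ < 1/10`, by Radziwiłł–Soundararajan
2015, Prop. 2 (`NonvanishingTwistsHoffsteinLuoMomentProofs.lean`, module docstring and
`HoffsteinLuo1997.forall_exists_twist_card_le_twenty_of_firstMoment_RS`). Proof: for elliptic `W`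
the newform `f_W` (`hmod`) turns `hlevelNF` into the hypothesis of
`HoffsteinLuo1997.forall_exists_twist_card_le_of_levelOfDistribution r`
(`HoffsteinLuo1997.entireLFunction_quadraticTwist_one_eq_of_modEq_sq`).
[cite: HoffsteinLuo1997, Theorem, §2 (3)–(12) and p. 438] -/
theorem HoffsteinLuo1997.forall_exists_twist_card_le_of_newform_levelOfDistribution (r : ℕ)
    (hpos : WeierstrassCurve.re_entireLFunction_one_nonneg) (hmod : exists_isNewformOf)
    (hlevelNF : ∀ {N : ℕ} [NeZero N] (f : CuspForm (Gamma0 N) 2), IsNewform0 f →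
      ∀ (M : ℕ), M ≠ 0 → N ∣ M →
      ∃ (ε : ℤ) (C B a b : ℝ) (ρ : ArithmeticFunction ℝ) (F : ℝ → ℝ) (Lv : ℕ → ℂ)
        (θ δ K Y₁ : ℝ),
        (ε = 1 ∨ ε = -1) ∧ 0 < C ∧ 0 ≤ B ∧ ρ.IsMultiplicative ∧
        (∀ p : ℕ, p.Prime → ¬ p ∣ 4 * M → 0 ≤ ρ p ∧ ρ p < p ∧ |ρ p - 1| ≤ B / p) ∧
        0 < a ∧ b < 1 ∧ (∀ t, 0 ≤ F t) ∧ (∀ t, F t ≠ 0 → a ≤ t ∧ t ≤ b) ∧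
        (∀ n : ℕ, Squarefree n → (∃ ν ∈ Finset.range (4 * M), ν.Coprime (4 * M) ∧
            (ε * n : ℤ) ≡ ((ν : ℤ) ^ 2) [ZMOD ((4 * M : ℕ) : ℤ)]) →
          ∃ L : ℂ → ℂ, Differentiable ℂ L ∧
            (∀ s : ℂ, (2 : ℝ) < s.re →
              L s = LSeries (fun m : ℕ ↦ (jacobiSym m n : ℂ) * cuspCoeff f m) s) ∧ L 1 = Lv n) ∧
        2 < θ * (r + 1) ∧ 0 < δ ∧
        ∀ Y : ℝ, Y₁ ≤ Y →
          ∑ d ∈ (Finset.range ⌈Y ^ θ⌉₊).filter (fun d : ℕ => Squarefree d ∧ d.Coprime (4 * M) ∧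
              ∀ p ∈ d.primeFactors, (p : ℝ) < Y ^ (1 / ((r : ℝ) + 1))),
            ‖(∑ n ∈ (Finset.Ioc 0 ⌊Y⌋₊).filter (fun n : ℕ => d ∣ n ∧ Squarefree n ∧
                  ∃ ν ∈ Finset.range (4 * M), ν.Coprime (4 * M) ∧
                    (ε * n : ℤ) ≡ ((ν : ℤ) ^ 2) [ZMOD ((4 * M : ℕ) : ℤ)]),
                Lv n * (F (n / Y) : ℂ)) - ((C * (ρ d / d) * Y : ℝ) : ℂ)‖ ≤ K * Y ^ (1 - δ)) :
    ∀ (W : WeierstrassCurve ℚ) [W.IsElliptic] (S : Finset ℕ) (Bd : ℕ),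
      ∃ d : ℤ, Bd < d.natAbs ∧ Squarefree d ∧ d % 8 = 1 ∧ d.natAbs.primeFactors.card ≤ r ∧
        (∀ p ∈ S, p.Prime → p ≠ 2 → jacobiSym d p = 1) ∧
          (W.quadraticTwist (d : ℚ)).entireLFunction 1 ≠ 0 := by
  refine HoffsteinLuo1997.forall_exists_twist_card_le_of_levelOfDistribution r hpos
    fun W _ M hM0 hNM ↦ ?_
  have hN : 0 < W.conductorNorm ℤ := W.conductorNorm_pos_holds
  haveI : NeZero (W.conductorNorm ℤ) := ⟨hN.ne'⟩
  obtain ⟨f, hf⟩ := hmod W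
  obtain ⟨ε, C, B, a, b, ρ, F, Lv, θ, δ, K, Y₁, hε, hC, hB, hρ, hρp, ha, hb, hF0, hFsupp, hLv, hθ,
    hδ, hlev⟩ := hlevelNF f hf.1 M hM0 hNM
  -- `Λ(n) = Lv n = L(W^{(εn)}, 1)` on `Δ^ε`
  have hval : ∀ n : ℕ, Squarefree n → (∃ ν ∈ Finset.range (4 * M), ν.Coprime (4 * M) ∧
      (ε * n : ℤ) ≡ ((ν : ℤ) ^ 2) [ZMOD ((4 * M : ℕ) : ℤ)]) →
      (W.quadraticTwist ((ε * n : ℤ) : ℚ)).entireLFunction 1 = Lv n := fun n hsq hmem ↦ by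
    obtain ⟨L, hLdiff, hLeq, hL1⟩ := hLv n hsq hmem
    obtain ⟨ν, -, hν, hmodν⟩ := hmem
    rw [HoffsteinLuo1997.entireLFunction_quadraticTwist_one_eq_of_modEq_sq W hf hNM hε hsq hν
      hmodν hLdiff hLeq, hL1]
  refine ⟨ε, C, B, a, b, ρ, F, θ, δ, K, Y₁, hε, hC, hB, hρ, hρp, ha, hb, hF0, hFsupp, hθ, hδ,
    fun Y hY ↦ le_of_eq_of_le ?_ (hlev Y hY)⟩
  refine Finset.sum_congr rfl fun d _ ↦ ?_
  congr 2
  refine Finset.sum_congr rfl fun n hn ↦ ?_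
  rw [Finset.mem_filter] at hn
  rw [hval n hn.2.2.1 hn.2.2.2]

end Literature.NumberTheory.EllipticCurves

end
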